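import Summits.Ventures.CertifiedArithmetic.LowPrec.SRExitGrowth
import HarnessLib

/-!
# Stochastic rounding into a finite format, XXIV: SR accumulation of a constant is a counting chain

HONEST FRAMING: certified error envelopes and provably optimal rounding/accumulation schemes for
low-precision formats under stated cost models; every table by two implementations; no hardware or
vendor claims.

Venture CertifiedArithmetic / lowprec, SR slice (gen5).  The recursive SR summation of a CONSTANT
increment `c` (counting events, accumulating equal magnitudes) is a Markov chain on `F` with kernel
`a ↦ SR(a + c)`: from a format value `a` it moves to the successor `a⁺` with probability
`c / (a⁺ − a)` (when `a < a + c ≤ a⁺`) — for `c = 1` this is EXACTLY the probabilistic counter of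
Morris / Flajolet / Csűrös ("increment with probability one over the gap"), whose published analyses
give unbiasedness and variance and assume overflow negligible.  This file makes the dictionary a
theorem and supplies what the counter literature leaves out — the overflow (= saturation) law:

* `treeExp_comb_const`: `E f(ŝ)` of the `k`-step recursive sum `((s + c) + c) + ⋯ + c` is the
  `k`-fold Markov operator `iterOp` applied to `f` at `s` (dimension ONE, not `2^k` branches);
* `exitE_comb_const_eq_hitProb`: the probability that some partial sum fires an exit predicate within
  `k` steps is the hitting probability `hitProb k s` of the one-line backward recursion
  `h₀ = 0`, `h_{k+1}(a) = [e(a+c)] + [¬e(a+c)]·E h_k(SR(a+c))`;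
* `cornerUp_eq_hitProb`: the kernel rows of file XIX are values of this recursion (every `n`);
* **all-`n` theorem, E2M1** (`Count.e2m1_ones_satProb`): the recursive SR sum of `n ≥ 5` ones in
  FP4 E2M1 saturates with probability EXACTLY `1 − 2^{−(n−5)}` (deterministic `1,2,3,4`, then a
  geometric wait at `4` for the jump to `6`, then sure exit) — the kernel instances of files XVIII/XIX
  (`n = 6, 7, 8, 9`: `1/2, 3/4, 7/8, 15/16`) for every `n` at once; with the box certificate:
  every recursive E2M1 SR sum of `n ≥ 5` rationals in `[0,1]` saturates w.p. `≤ 1 − 2^{−(n−5)}`,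
  and of `n` rationals `≥ 1` w.p. `≥ 1 − 2^{−(n−5)}`.

* **all-`n` law, E3M2** (`CountE3M2.chain`, `CountE3M2.e3m2_ones_satProb`): the recursive SR sum
  of `k + 8` ones in FP6 E3M2 saturates with probability exactly `h_k(8)`, where `h` is the explicit
  7-state absorbing chain (`1, 2, …, 8` deterministic; geometric waits with success probability
  `1/2` at `8, 10, 12, 14` and `1/4` at `16, 20, 24`; sure exit from `28`) — i.e. the time to
  saturation is `8 + NB(4,½) + NB(3,¼)`, a phase-type law; `CountE3M2.h_24` is the closed form of
  the last wait and `CountE3M2.rows` ties the chain to the three kernel rows of file XIX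
  (`2^{−10}`, `18112973/2^26`, `3260157053385/2^42` at `n = 16, 24, 32`).  The negative-binomial
  closed form is cross-checked against the DP law by two implementations outside Lean
  (`certs/sr/gen5/counter/`).
-/

namespace Summit.Ventures.CertifiedArithmetic.LowPrec.SR

open Literature.ComputerArithmetic.ConnollyHighamMary2021 Finset STree

variable {K : Type*} [Field K] [LinearOrder K] [IsStrictOrderedRing K]

/-! ### The Markov operator of the constant-increment chain -/

/-- `iterOp F c k f a = E f(ŝ)` for the `k`-step chain `ŝ₀ = a`, `ŝ_{i+1} = SR(ŝ_i + c)`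
(the `k`-fold operator `f ↦ (a ↦ E f(SR(a + c)))`). -/
def iterOp (F : Finset K) (c : K) : ℕ → (K → K) → K → K
  | 0, f => f
  | k + 1, f => iterOp F c k (fun a => step F (a + c) f)

omit [IsStrictOrderedRing K] in
/-- **Recursive SR summation of a constant is the `k`-fold Markov operator** (one-dimensional). -/
theorem treeExp_comb_const (F : Finset K) (c s : K) :
    ∀ (k : ℕ) (f : K → K), treeExp F (comb (fun _ => c) s k) f = iterOp F c k f s
  | 0, _ => rfl
  | k + 1, f => by
      simp only [comb, treeExp, iterOp]
      exact treeExp_comb_const F c s k _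

/-! ### The hitting probability recursion -/

/-- `hitProb F e c k a` = probability that, started at `a`, some pre-rounding value `ŝ_i + c`
(`i < k`) satisfies the exit predicate `e`:  `h₀ = 0`,
`h_{k+1}(a) = if e (a + c) then 1 else E h_k(SR(a + c))`. -/
def hitProb (F : Finset K) (e : K → Bool) (c : K) : ℕ → K → K
  | 0, _ => 0
  | k + 1, a => if e (a + c) then 1 else step F (a + c) (hitProb F e c k)

omit [IsStrictOrderedRing K] in
/-- Key identity: integrating `h_k` against the flagged law of the `n`-step comb gives the exit
probability of the `(n + k)`-step comb. -/
theorem treeExpE_comb_hitProb (F : Finset K) (e : K → Bool) (c s : K) :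
    ∀ (k n : ℕ), treeExpE F e (comb (fun _ => c) s n)
        (fun v fl => if fl then 1 else hitProb F e c k v) = exitE F e (comb (fun _ => c) s (n + k))
  | 0, n => by simp [hitProb, exitE]
  | k + 1, n => by
      rw [show n + (k + 1) = (n + 1) + k by omega, ← treeExpE_comb_hitProb F e c s k (n + 1)]
      simp only [comb, treeExpE, Bool.or_false]
      refine treeExpE_congr F e _ (fun a fa => ?_)
      cases fa
      · simp only [Bool.false_or, hitProb]
        cases e (a + c)
        · simp
        · simp [step_const]
      · simp [step_const]

omit [IsStrictOrderedRing K] in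
/-- **Exit probability of the `k`-step constant-increment comb = the hitting probability `h_k(s)`.** -/
theorem exitE_comb_const_eq_hitProb (F : Finset K) (e : K → Bool) (c s : K) (k : ℕ) :
    exitE F e (comb (fun _ => c) s k) = hitProb F e c k s := by
  have h := treeExpE_comb_hitProb F e c s k 0
  simp only [comb, treeExpE, Nat.zero_add] at h
  simpa using h.symm

/-- The kernel rows of file XIX are values of the one-dimensional recursion (every `n`). -/
theorem LawE3M2.cornerUp_eq_hitProb (n : ℕ) :
    LawE3M2.cornerUp n = hitProb Formats.e3m2 (fun c => decide ((28 : ℚ) < c)) 1 n 1 := by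
  rw [← LawE3M2.cornerUp_eq, exitE_comb_const_eq_hitProb]

/-! ### All-`n` closed form: FP4 E2M1, counting by ones -/

namespace Count

/-- The upper-exit predicate of E2M1 (`maxRat = 6`). -/
def upE : ℚ → Bool := fun c => decide ((6 : ℚ) < c)

/-- The hitting recursion of the ones chain in E2M1, abbreviated. -/
def h (k : ℕ) (a : ℚ) : ℚ := hitProb FP4.e2m1 upE 1 k a

/-- One SR step of `5` in E2M1: candidates `4, 6`, probability `1/2` each. -/
theorem step_five (f : ℚ → ℚ) : step FP4.e2m1 5 f = 1 / 2 * f 6 + (1 - 1 / 2) * f 4 := by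
  have hu : up FP4.e2m1 (5 : ℚ) = 6 := by decide +kernel
  have hd : dn FP4.e2m1 (5 : ℚ) = 4 := by decide +kernel
  have hp : pUp FP4.e2m1 (5 : ℚ) = 1 / 2 := by decide +kernel
  unfold step; rw [hu, hd, hp]

/-- At `6` the next increment exits surely. -/
theorem h_six (k : ℕ) : h (k + 1) 6 = 1 := by
  simp [h, hitProb, upE]

/-- At `4`: a geometric wait — `h_{k+1}(4) = ½ h_k(6) + ½ h_k(4)`. -/
theorem h_four_succ (k : ℕ) : h (k + 1) 4 = 1 / 2 * h k 6 + (1 - 1 / 2) * h k 4 := by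
  have he : upE (4 + 1) = false := by decide +kernel
  show hitProb FP4.e2m1 upE 1 (k + 1) 4 = _
  simp only [hitProb, he]
  rw [show (4 : ℚ) + 1 = 5 by norm_num, step_five]; rfl

/-- Closed form at `4`: `h_{k+1}(4) = 1 − 2^{−k}`. -/
theorem h_four (k : ℕ) : h (k + 1) 4 = 1 - (1 / 2) ^ k := by
  induction k with
  | zero =>
      rw [h_four_succ]; simp [h, hitProb]
  | succ k ih =>
      rw [h_four_succ, h_six, ih, pow_succ]; ring

/-- Below `4` the chain is deterministic: `h_{k+1}(a) = h_k(a + 1)` for `a + 1 ∈ {2, 3, 4}`. -/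
theorem h_det {a : ℚ} (ha : a + 1 ∈ FP4.e2m1) (he : upE (a + 1) = false) (k : ℕ) :
    h (k + 1) a = h k (a + 1) := by
  show hitProb FP4.e2m1 upE 1 (k + 1) a = _
  simp only [hitProb, he]
  exact step_of_mem ha _

/-- From the start value `1`: three deterministic steps, then the geometric wait. -/
theorem h_one (k : ℕ) : h (k + 4) 1 = 1 - (1 / 2) ^ k := by
  have e2 : upE ((1 : ℚ) + 1) = false := by decide +kernel
  have e3 : upE ((2 : ℚ) + 1) = false := by decide +kernel
  have e4 : upE ((3 : ℚ) + 1) = false := by decide +kernel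
  have m2 : (1 : ℚ) + 1 ∈ FP4.e2m1 := by decide +kernel
  have m3 : (2 : ℚ) + 1 ∈ FP4.e2m1 := by decide +kernel
  have m4 : (3 : ℚ) + 1 ∈ FP4.e2m1 := by decide +kernel
  rw [show k + 4 = (k + 3) + 1 by omega, h_det m2 e2, show (1 : ℚ) + 1 = 2 by norm_num,
    show k + 3 = (k + 2) + 1 by omega, h_det m3 e3, show (2 : ℚ) + 1 = 3 by norm_num,
    show k + 2 = (k + 1) + 1 by omega, h_det m4 e4, show (3 : ℚ) + 1 = 4 by norm_num, h_four]

/-- **All-`n` theorem (E2M1, counting by ones).** The recursive SR sum of `k + 5` ones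
(`((1 + 1) + 1) + ⋯`, `k + 4` additions) exits upward with probability exactly `1 − 2^{−k}`. -/
theorem e2m1_ones_exitUp (k : ℕ) :
    exitE FP4.e2m1 upE (comb (fun _ => (1 : ℚ)) 1 (k + 4)) = 1 - (1 / 2) ^ k := by
  rw [exitE_comb_const_eq_hitProb]; exact h_one k

/-- **… and saturates with probability exactly `1 − 2^{−k}`** (no lower exit for nonnegative data). -/
theorem e2m1_ones_satProb (k : ℕ) :
    satProbT FP4.e2m1 (comb (fun _ => (1 : ℚ)) 1 (k + 4)) = 1 - (1 / 2) ^ k := by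
  obtain ⟨hlo, hhi, h0, hb⟩ := Box.e2m1_hull
  refine le_antisymm ?_ ?_
  · have h₁ : LeafLE ((comb (fun _ => (1 : ℚ)) 1 (k + 4)).map fun _ => (0 : ℚ))
        (comb (fun _ => (1 : ℚ)) 1 (k + 4)) := by
      rw [map_comb]; exact leafLE_comb (by norm_num) (fun _ => by norm_num) _
    have h := satProbT_le_upper_corner hlo hhi hb h0 (by norm_num) h₁ (LeafLE.refl _)
    rwa [show (fun c => decide ((6 : ℚ) < c)) = upE from rfl, e2m1_ones_exitUp] at h
  · have h := exitE_upper_le_satProbT hlo hhi hb (comb (fun _ => (1 : ℚ)) 1 (k + 4))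
    rwa [show (fun c => decide ((6 : ℚ) < c)) = upE from rfl, e2m1_ones_exitUp] at h

/-- **Box form, every `n ≥ 5`**: every recursive E2M1 SR sum of `k + 5` rationals in `[0, 1]`
saturates with probability at most `1 − 2^{−k}`; of `k + 5` rationals `≥ 1`, at least `1 − 2^{−k}`. -/
theorem e2m1_box_all_n (k : ℕ) (x : ℕ → ℚ) (s : ℚ) :
    ((0 ≤ s ∧ s ≤ 1) → (∀ i, 0 ≤ x i ∧ x i ≤ 1) →
      satProbT FP4.e2m1 (comb x s (k + 4)) ≤ 1 - (1 / 2) ^ k) ∧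
    (1 ≤ s → (∀ i, 1 ≤ x i) → 1 - (1 / 2) ^ k ≤ satProbT FP4.e2m1 (comb x s (k + 4))) := by
  obtain ⟨hlo, hhi, h0, hb⟩ := Box.e2m1_hull
  refine ⟨fun hs hx => ?_, fun hs hx => ?_⟩
  · have h₁ : LeafLE ((comb x s (k + 4)).map fun _ => (0 : ℚ)) (comb x s (k + 4)) := by
      rw [map_comb]; exact leafLE_comb hs.1 (fun i => (hx i).1) _
    have h₂ : LeafLE (comb x s (k + 4)) (comb (fun _ => (1 : ℚ)) 1 (k + 4)) :=
      leafLE_comb hs.2 (fun i => (hx i).2) _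
    have h := satProbT_le_upper_corner hlo hhi hb h0 (by norm_num) h₁ h₂
    rwa [show (fun c => decide ((6 : ℚ) < c)) = upE from rfl, e2m1_ones_exitUp] at h
  · have h := corner_le_satProbT hlo hhi hb (x := fun _ => (1 : ℚ)) (s := 1) hs hx (le_refl (k + 4))
    rwa [show (fun c => decide ((6 : ℚ) < c)) = upE from rfl, e2m1_ones_exitUp] at h

end Count

/-! ### All-`n` law: FP6 E3M2, counting by ones — an explicit 7-state absorbing chain -/

namespace CountE3M2

/-- The upper-exit predicate of E3M2 (`maxRat = 28`). -/
def upE : ℚ → Bool := fun c => decide ((28 : ℚ) < c)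

/-- The hitting recursion of the ones chain in E3M2, abbreviated. -/
def h (k : ℕ) (a : ℚ) : ℚ := hitProb Formats.e3m2 upE 1 k a

/-- Generic randomized step: `h_{k+1}(a) = p·h_k(u) + (1 − p)·h_k(d)` from the three rounding data
of `a + 1`. -/
theorem h_rand {a u d p : ℚ} (he : upE (a + 1) = false) (hu : up Formats.e3m2 (a + 1) = u)
    (hd : dn Formats.e3m2 (a + 1) = d) (hp : pUp Formats.e3m2 (a + 1) = p) (k : ℕ) :
    h (k + 1) a = p * h k u + (1 - p) * h k d := by
  show hitProb Formats.e3m2 upE 1 (k + 1) a = _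
  simp only [hitProb, he]
  unfold step; rw [hu, hd, hp]; rfl

/-- Generic deterministic step: `h_{k+1}(a) = h_k(a + 1)` when `a + 1` is a format value. -/
theorem h_det {a : ℚ} (ha : a + 1 ∈ Formats.e3m2) (he : upE (a + 1) = false) (k : ℕ) :
    h (k + 1) a = h k (a + 1) := by
  show hitProb Formats.e3m2 upE 1 (k + 1) a = _
  simp only [hitProb, he]
  exact step_of_mem ha _

/-- **The E3M2 ones chain, every `k`**: sure exit from `28`; geometric waits with success
probability `1/4` at `24, 20, 16` (gap `4`) and `1/2` at `14, 12, 10, 8` (gap `2`).  Hence the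
time to saturation from `8` is `1 + NB(3, 1/4) + NB(4, 1/2)` (independent negative binomials). -/
theorem chain (k : ℕ) :
    h (k + 1) 28 = 1 ∧
    h (k + 1) 24 = 1 / 4 * h k 28 + (1 - 1 / 4) * h k 24 ∧
    h (k + 1) 20 = 1 / 4 * h k 24 + (1 - 1 / 4) * h k 20 ∧
    h (k + 1) 16 = 1 / 4 * h k 20 + (1 - 1 / 4) * h k 16 ∧
    h (k + 1) 14 = 1 / 2 * h k 16 + (1 - 1 / 2) * h k 14 ∧
    h (k + 1) 12 = 1 / 2 * h k 14 + (1 - 1 / 2) * h k 12 ∧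
    h (k + 1) 10 = 1 / 2 * h k 12 + (1 - 1 / 2) * h k 10 ∧
    h (k + 1) 8 = 1 / 2 * h k 10 + (1 - 1 / 2) * h k 8 := by
  refine ⟨?_, ?_, ?_, ?_, ?_, ?_, ?_, ?_⟩
  · have he : upE (28 + 1) = true := by decide +kernel
    show hitProb Formats.e3m2 upE 1 (k + 1) 28 = _
    simp only [hitProb, he]; rfl
  · exact h_rand (a := 24) (by decide +kernel) (by decide +kernel) (by decide +kernel)
      (by decide +kernel) k
  · exact h_rand (a := 20) (by decide +kernel) (by decide +kernel) (by decide +kernel)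
      (by decide +kernel) k
  · exact h_rand (a := 16) (by decide +kernel) (by decide +kernel) (by decide +kernel)
      (by decide +kernel) k
  · exact h_rand (a := 14) (by decide +kernel) (by decide +kernel) (by decide +kernel)
      (by decide +kernel) k
  · exact h_rand (a := 12) (by decide +kernel) (by decide +kernel) (by decide +kernel)
      (by decide +kernel) k
  · exact h_rand (a := 10) (by decide +kernel) (by decide +kernel) (by decide +kernel)
      (by decide +kernel) k
  · exact h_rand (a := 8) (by decide +kernel) (by decide +kernel) (by decide +kernel)
      (by decide +kernel) k

/-- The initial value: `h₀ = 0` everywhere. -/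
theorem h_zero (a : ℚ) : h 0 a = 0 := rfl

/-- Closed form of the last wait: `h_{k+1}(24) = 1 − (3/4)^k`. -/
theorem h_24 (k : ℕ) : h (k + 1) 24 = 1 - (3 / 4) ^ k := by
  induction k with
  | zero => rw [(chain 0).2.1, h_zero, h_zero]; norm_num
  | succ k ih => rw [(chain (k + 1)).2.1, (chain k).1, ih, pow_succ]; ring

/-- From the start value `1`: seven deterministic steps `1, 2, …, 8`. -/
theorem h_start (k : ℕ) : h (k + 7) 1 = h k 8 := by
  have d : ∀ a : ℚ, a + 1 ∈ Formats.e3m2 → upE (a + 1) = false → ∀ j, h (j + 1) a = h j (a + 1) :=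
    fun a ha he j => h_det ha he j
  rw [show k + 7 = (k + 6) + 1 by omega, d 1 (by decide +kernel) (by decide +kernel),
    show (1 : ℚ) + 1 = 2 by norm_num,
    show k + 6 = (k + 5) + 1 by omega, d 2 (by decide +kernel) (by decide +kernel),
    show (2 : ℚ) + 1 = 3 by norm_num,
    show k + 5 = (k + 4) + 1 by omega, d 3 (by decide +kernel) (by decide +kernel),
    show (3 : ℚ) + 1 = 4 by norm_num,
    show k + 4 = (k + 3) + 1 by omega, d 4 (by decide +kernel) (by decide +kernel),
    show (4 : ℚ) + 1 = 5 by norm_num,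
    show k + 3 = (k + 2) + 1 by omega, d 5 (by decide +kernel) (by decide +kernel),
    show (5 : ℚ) + 1 = 6 by norm_num,
    show k + 2 = (k + 1) + 1 by omega, d 6 (by decide +kernel) (by decide +kernel),
    show (6 : ℚ) + 1 = 7 by norm_num, d 7 (by decide +kernel) (by decide +kernel),
    show (7 : ℚ) + 1 = 8 by norm_num]

/-- **All-`n` law (E3M2, counting by ones).** The recursive SR sum of `k + 8` ones saturates with
probability exactly `h_k(8)`, the `8`-coordinate of the explicit chain `chain` started from `0`
(= `P(1 + NB(3,¼) + NB(4,½) ≤ k)`). -/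
theorem e3m2_ones_satProb (k : ℕ) :
    satProbT Formats.e3m2 (comb (fun _ => (1 : ℚ)) 1 (k + 7)) = h k 8 := by
  obtain ⟨hlo, hhi, h0, hb⟩ := LawE3M2.e3m2_hull
  have hx : exitE Formats.e3m2 upE (comb (fun _ => (1 : ℚ)) 1 (k + 7)) = h k 8 := by
    rw [exitE_comb_const_eq_hitProb]; exact h_start k
  refine le_antisymm ?_ ?_
  · have h₁ : LeafLE ((comb (fun _ => (1 : ℚ)) 1 (k + 7)).map fun _ => (0 : ℚ))
        (comb (fun _ => (1 : ℚ)) 1 (k + 7)) := by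
      rw [map_comb]; exact leafLE_comb (by norm_num) (fun _ => by norm_num) _
    have h := satProbT_le_upper_corner hlo hhi hb h0 (by norm_num) h₁ (LeafLE.refl _)
    rwa [show (fun c => decide ((28 : ℚ) < c)) = upE from rfl, hx] at h
  · have h := exitE_upper_le_satProbT hlo hhi hb (comb (fun _ => (1 : ℚ)) 1 (k + 7))
    rwa [show (fun c => decide ((28 : ℚ) < c)) = upE from rfl, hx] at h

/-- Consistency with the kernel rows of file XIX: `h₈(8) = 2^{−10}` (`n = 16`),
`h₁₆(8) = 18112973/2^26` (`n = 24`), `h₂₄(8) = 3260157053385/2^42` (`n = 32`). -/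
theorem rows : h 8 8 = 1 / 1024 ∧ h 16 8 = 18112973 / 67108864 ∧
    h 24 8 = 3260157053385 / 4398046511104 := by
  refine ⟨?_, ?_, ?_⟩
  · have t := LawE3M2.cornerUp_15
    rw [LawE3M2.cornerUp_eq_hitProb] at t
    rw [← h_start]; exact t
  · have t := LawE3M2.cornerUp_23
    rw [LawE3M2.cornerUp_eq_hitProb] at t
    rw [← h_start]; exact t
  · have t := LawE3M2.cornerUp_31
    rw [LawE3M2.cornerUp_eq_hitProb] at t
    rw [← h_start]; exact t

end CountE3M2

end Summit.Ventures.CertifiedArithmetic.LowPrec.SR
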